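import Literature.NumberTheory.Rogawski1990.Ch12Sec5Inputs   -- ★ the (S-𝔇) SOCKETS `EllipticData.EllipticOfL2` (ELL), `IsPseudoCoeff`, `IsEllipticRep`, `IsL2`, `orbInt` (brings ★ `Ch12Sec5Defs`, ★ `LocalOrbitalIntegral`)
import Literature.NumberTheory.Rogawski1990.Ch12Sec6         -- ★ the CARPET relation `Ch12Sec6.PseudoCoeffExists` [§12.6 p. 187, [K]] (§2 corollary only)
import HarnessLib

/-!
# F0 · P3c · line LH6 «StCharTS» — brick «ELL-OUT★» for the (S-𝔇) package `stub_EllipticPackage`: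
# THE SOCKET (ELL) `EllipticOfL2` («square-integrable ⇒ elliptic») DERIVED FROM THE PACKAGE'S (PL) PAIR «`f_π(1) = d(π)`, `d(π) > 0`»

Cell `hodgecm-mathlib`, crux `H413` (`stmt-HodgeConjecture-24833`), line LH6 `Cruxes/H413/Lines/F0_P3c_StCharTSPaydown.lean` (organ (S-𝔇) `stub_EllipticPackage`: an
existential over a §12.5 datum `𝔇 : Ch12Sec5.EllipticData (U(Φ₃)(L⁺_v)) (H_v)`, a formal-degree function `d`, a type-(3) Cartan subgroup `T` and a parameter map
`par`; among its conjuncts the SOCKETS of ★ `Ch12Sec5Inputs` — printed inputs no carpet states — and the two (PL) clauses of [Rogawski1990, L. 12.7.2 (proof) p. 194]).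
Seat LH6-p03 (g4); THEOREMS ONLY (no `def`, no named fact, no `instance`, no notation, no `sorry`; axioms ⊆ {propext, Classical.choice, Quot.sound});
`--supports stmt-HodgeConjecture-24833`.  Sequel to ★ «SOCKETS-OUT★» (p850909: (LDSE), (DENS), the `G`-half of (DEF)) and ★ «LDSU-OUT★» (p851084: (LDSU)).
HONEST LABEL: HC_CM is proved only modulo the 7 printed citations (2 remaining: hLiu418 = stmt-HodgeConjecture-24832, h413 = stmt-HodgeConjecture-24833) until rung 0
closes; this file is count-neutral — it lets a later leaf edition DELETE the socket (ELL) ★ `EllipticData.EllipticOfL2` (ED. 14 (S-𝔇), binder `hEll` of the three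
`obtain` patterns, consumed by the (S-a) head ★ `stSupportFiniteSqInt_of_carpet_torus₉`, by ★ `stEllipticNormTwo_of_carpet_of_lds_not_L2` and by ★ `stSignBalance_of_carpet`),
feeding that binder BY NAME from the (PL) pair the package keeps (binders `hPl`, `hdpos`).

THE MATHEMATICS (elementary; generic carriers `G`, `H`; print keeps [K] = [Kazhdan1986] for (ELL) — what is shown here is a LOGICAL REDUNDANCY of the package as
typed, not a new proof of Kazhdan's theorem).  Recall the package's two (PL) clauses [L. 12.7.2 (proof) p. 194: «by the Plancherel formula, `f_π(1) = d(π)`»; «the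
formal degrees `d(π)` are positive»], typed with the formal degree as a FUNCTION `d : E(G) → ℝ` on classes:
  (PL1) for every square-integrable `π` and EVERY pseudo-coefficient `f` of `π` (★ `IsPseudoCoeff π f`: `f ∈ C_c^∞(G)`, `Φ(γ, f) = 0` on `G^r ∖ G^e`, `Φ(γ, f) =
        \overline{χ_π(γ)}` on `G^e` [§12.6 p. 187]), `f(1) = d(π)`;
  (PL2) `d(π) > 0` for every square-integrable `π`.
If a square-integrable class `π` were NOT elliptic in the sense of §12.6 (★ `IsEllipticRep`: «the character `χ_π` does not vanish identically on `G^e`», p. 187), i.e.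
`χ_π ≡ 0` on `G^e`, then the ZERO FUNCTION is a pseudo-coefficient of `π`: `0 ∈ C_c^∞(G)`, and every orbital integral of `0` vanishes (★ `orbitalIntegral_zero_fun`), which
is `= 0` on `G^r ∖ G^e` and `= \overline{χ_π(γ)} = 0` on `G^e` (§1 `isPseudoCoeff_zero_of_char_eq_zero_on_ellG`).  (PL1) at `f = 0` gives `d(π) = 0(1) = 0`, contradicting
(PL2).  Hence **(ELL) ⟸ (PL1) ∧ (PL2)**: `ellipticOfL2_of_PL` (§2), with the pointwise form `isEllipticRep_of_forall_pseudoCoeff_apply_one_ne_zero` («if every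
pseudo-coefficient of `π` is non-zero at `1`, then `π` is elliptic»).  Print's own order is the other way round ([K] gives ellipticity and the pseudo-coefficient, then
Plancherel gives `f_π(1) = d(π) > 0`); inside the ∃-package both are conjuncts about the same posited `𝔇`, `d`, and the typed (PL1) quantifies over ALL pseudo-coefficients
— including the degenerate one that exists exactly when `χ_π|_{G^e} ≡ 0`.
WHY IT PAYS (datum-construction programme): (ELL) at a concrete datum is Kazhdan's theorem [K] Thm. 4.1 ∕ the orthogonality relations (PRINT STATUS of ★ `EllipticOfL2`:
ASSERTED p. 187, EXTERNAL); this brick trades it for the (PL) pair, which the package owes anyway for (S-b2).  Nothing is weakened: the leaf's (S-𝔇) loses one conjunct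
and every consumer is fed the same proposition by name.

LEAF EFFECT (for the integrator heir, a later ED. of `Cruxes/H413/Lines/F0_P3c_StCharTSPaydown.lean`; NOT done here): delete the conjunct `𝔇.EllipticOfL2 ∧` from
(S-𝔇), drop `hEll` from the three `obtain` patterns, and feed `(F0P3cStCharTSEllOut.ellipticOfL2_of_PL 𝔇 d hPl hdpos)` in each former `hEll` slot ((S-a) call, (S-b1)
call, (S-b2)'s two calls) — every argument an existing binder (`d` the ∃-witness, `hPl`∕`hdpos` = the (PL) pair).

## References
* [Rogawski1990] J. D. Rogawski, *Automorphic Representations of Unitary Groups in Three Variables*, Ann. of Math. Stud. 123 (1990): §12.6 p. 187 («elliptic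
  representation», «pseudo-coefficient», «All representations of this type are in fact elliptic … by an application of the results of [K]»); §12.7 Lemma 12.7.2
  (proof) p. 194 («`f_π(1) = d(π)`», formal degrees positive); §1.6 p. 5 (square-integrable modulo the centre).
* [Kazhdan1986] D. Kazhdan, *Cuspidal geometry of p-adic groups*, J. Analyse Math. 47 (1986), Thm. 4.1 (the print's [K]; cited for context only — not used).
-/

set_option autoImplicit false
-- the mandated namespace has the single-problem summit's repeated segment (`HodgeConjecture.HodgeConjecture`)
set_option linter.dupNamespace false

noncomputable section

open MeasureTheory
open Literature.NumberTheory.Automorphic Literature.NumberTheory.Rogawski1990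

namespace Summit.HodgeConjecture.HodgeConjecture.Cruxes.H413.F0P3cStCharTSEllOut

variable {G H : Type} [Group G] [TopologicalSpace G] [IsTopologicalGroup G] [MeasurableSpace G]
  [∀ γ : G, MeasurableSpace (G ⧸ Subgroup.centralizer ({γ} : Set G))] [MeasurableSpace (G ⧸ Subgroup.center G)]
  [Group H] [TopologicalSpace H] [IsTopologicalGroup H] [MeasurableSpace H]
  (𝔇 : Ch12Sec5.EllipticData G H)

/-! ## §1 The degenerate pseudo-coefficient -/

/-- **Every orbital integral of the zero function vanishes**: `Φ(γ, 0) = 0` for the datum's orbital-integral family (★ `EllipticData.orbInt` = ★ `classOrbitalIntegral`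
at the class of `γ`; ★ `orbitalIntegral_zero_fun`). [cite: Rogawski1990, §12.5 p. 182] -/
theorem orbInt_zero_fun (γ : G) : 𝔇.orbInt γ (0 : G → ℂ) = 0 := by
  simp only [Ch12Sec5.EllipticData.orbInt, classOrbitalIntegral_eq, orbitalIntegral_zero_fun]

/-- **If `χ_π` vanishes identically on `G^e`, the zero function is a pseudo-coefficient of `π`** (★ `IsPseudoCoeff`, [§12.6 p. 187]: `0 ∈ C_c^∞(G)` = ★ `SchwartzBruhat G`,
`Φ(γ, 0) = 0` for `γ ∈ G^r ∖ G^e`, and `Φ(γ, 0) = 0 = \overline{χ_π(γ)}` for `γ ∈ G^e`). [cite: Rogawski1990, §12.6 p. 187] -/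
theorem isPseudoCoeff_zero_of_char_eq_zero_on_ellG (π : IrrClass G) (h0 : ∀ γ ∈ 𝔇.ellG, 𝔇.char π γ = 0) :
    𝔇.IsPseudoCoeff π (0 : G → ℂ) := by
  refine ⟨Submodule.zero_mem _, fun γ _ => orbInt_zero_fun 𝔇 γ, fun γ hγ => ?_⟩
  rw [orbInt_zero_fun, h0 γ hγ, map_zero]

/-- **Conversely, if `π` is NOT elliptic (★ `IsEllipticRep`: «`χ_π` does not vanish identically on `G^e`», [§12.6 p. 187]), then `χ_π ≡ 0` on `G^e`** (the negation,
spelled out). [cite: Rogawski1990, §12.6 p. 187] -/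
theorem char_eq_zero_on_ellG_of_not_isEllipticRep (π : IrrClass G) (hne : ¬ 𝔇.IsEllipticRep π) :
    ∀ γ ∈ 𝔇.ellG, 𝔇.char π γ = 0 := by
  intro γ hγ
  by_contra h
  exact hne ⟨γ, hγ, h⟩

/-- **A non-elliptic class has the zero function among its pseudo-coefficients.** [cite: Rogawski1990, §12.6 p. 187] -/
theorem isPseudoCoeff_zero_of_not_isEllipticRep (π : IrrClass G) (hne : ¬ 𝔇.IsEllipticRep π) :
    𝔇.IsPseudoCoeff π (0 : G → ℂ) :=
  isPseudoCoeff_zero_of_char_eq_zero_on_ellG 𝔇 π (char_eq_zero_on_ellG_of_not_isEllipticRep 𝔇 π hne)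

/-! ## §2 (ELL) derived from the (PL) pair -/

/-- **Pointwise form: if every pseudo-coefficient of `π` is non-zero at the identity, then `π` is elliptic** — otherwise the zero function would be a pseudo-coefficient
(§1) with value `0` at `1`. [cite: Rogawski1990, §12.6 p. 187; §12.7 Lemma 12.7.2 (proof) p. 194] -/
theorem isEllipticRep_of_forall_pseudoCoeff_apply_one_ne_zero (π : IrrClass G)
    (h : ∀ f : G → ℂ, 𝔇.IsPseudoCoeff π f → f 1 ≠ 0) :
    𝔇.IsEllipticRep π := by
  by_contra hne
  exact h 0 (isPseudoCoeff_zero_of_not_isEllipticRep 𝔇 π hne) rfl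

/-- **At one square-integrable class: (PL1) and (PL2) for `π` force `π` to be elliptic** — `f(1) = d(π)` for every pseudo-coefficient `f` of `π` and `d(π) > 0` leave no
room for the zero pseudo-coefficient. [cite: Rogawski1990, §12.7 Lemma 12.7.2 (proof) p. 194; §12.6 p. 187] -/
theorem isEllipticRep_of_PL_at (π : IrrClass G) (dπ : ℝ)
    (hPl : ∀ f : G → ℂ, 𝔇.IsPseudoCoeff π f → f 1 = (dπ : ℂ)) (hdpos : 0 < dπ) :
    𝔇.IsEllipticRep π := by
  refine isEllipticRep_of_forall_pseudoCoeff_apply_one_ne_zero 𝔇 π fun f hf => ?_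
  rw [hPl f hf]
  exact_mod_cast hdpos.ne'

/-- **(ELL) ★ `EllipticData.EllipticOfL2` DERIVED: every square-integrable class is elliptic** — from the package's (PL) pair [L. 12.7.2 (proof) p. 194] read with the
formal degree as a function `d` on classes: (PL1) «`f(1) = d(π)` for every square-integrable `π` and every pseudo-coefficient `f` of `π`» and (PL2) «`0 < d(π)`».  If
`χ_π|_{G^e} ≡ 0` the zero function is a pseudo-coefficient of `π` (§1), so (PL1) gives `d(π) = 0`, against (PL2).  At the leaf's three calls the binder `hEll` becomes
`ellipticOfL2_of_PL 𝔇 d hPl hdpos` ((PL1)(PL2) = the (S-𝔇) clauses VERBATIM). [cite: Rogawski1990, §12.6 p. 187; §12.7 Lemma 12.7.2 (proof) p. 194] -/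
theorem ellipticOfL2_of_PL (d : IrrClass G → ℝ)
    (hPl : ∀ (π : IrrClass G) (f : G → ℂ), 𝔇.IsL2 π → 𝔇.IsPseudoCoeff π f → f 1 = (d π : ℂ))
    (hdpos : ∀ π : IrrClass G, 𝔇.IsL2 π → 0 < d π) :
    𝔇.EllipticOfL2 :=
  fun π hL2 => isEllipticRep_of_PL_at 𝔇 π (d π) (fun f hf => hPl π f hL2 hf) (hdpos π hL2)

/-- **Corollary: under (PL), every square-integrable class HAS a pseudo-coefficient** once pseudo-coefficients exist for elliptic classes (★ `Ch12Sec6.PseudoCoeffExists`,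
[§12.6 p. 187, [K]]) — the combination the (S-b2) head ★ `stSignBalance_of_carpet` consumes through `hPCE` and `hEll`. [cite: Rogawski1990, §12.6 p. 187; §12.7 Lemma 12.7.2 (proof) p. 194] -/
theorem exists_pseudoCoeff_of_isL2_of_PL (hPCE : Ch12Sec6.PseudoCoeffExists 𝔇) (d : IrrClass G → ℝ)
    (hPl : ∀ (π : IrrClass G) (f : G → ℂ), 𝔇.IsL2 π → 𝔇.IsPseudoCoeff π f → f 1 = (d π : ℂ))
    (hdpos : ∀ π : IrrClass G, 𝔇.IsL2 π → 0 < d π) (π : IrrClass G) (hL2 : 𝔇.IsL2 π) :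
    ∃ f : G → ℂ, 𝔇.IsPseudoCoeff π f :=
  hPCE π (ellipticOfL2_of_PL 𝔇 d hPl hdpos π hL2)

/-- **Corollary: under (PL), a pseudo-coefficient of a square-integrable class is not the zero function** (its value at `1` is the positive real `d(π)`).
[cite: Rogawski1990, §12.7 Lemma 12.7.2 (proof) p. 194] -/
theorem pseudoCoeff_ne_zero_of_PL (d : IrrClass G → ℝ)
    (hPl : ∀ (π : IrrClass G) (f : G → ℂ), 𝔇.IsL2 π → 𝔇.IsPseudoCoeff π f → f 1 = (d π : ℂ))
    (hdpos : ∀ π : IrrClass G, 𝔇.IsL2 π → 0 < d π) {π : IrrClass G} (hL2 : 𝔇.IsL2 π) {f : G → ℂ} (hf : 𝔇.IsPseudoCoeff π f) :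
    f ≠ 0 := by
  intro hf0
  have h1 : f 1 = (d π : ℂ) := hPl π f hL2 hf
  rw [hf0, Pi.zero_apply] at h1
  have hd : d π = 0 := by exact_mod_cast h1.symm
  exact absurd hd (hdpos π hL2).ne'

end Summit.HodgeConjecture.HodgeConjecture.Cruxes.H413.F0P3cStCharTSEllOut

end
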